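import Mathlib.Tactic
import HarnessLib

/-!
# Kozma–Nitzan's Question 8 at three relays — the pair-decomposition budget for CONJECTURE NX′ at a general first crossing (gen 30)

Support file (`--supports stmt-CriticalPhenomena-4575`, closed crux; independent mathematics on Kozma–Nitzan's Question 8,
arXiv:2401.12397 §5.5 p. 36), prover `prim-ineq-gen-6` (gen 30).  No definitions, no named facts, no sorries; standard axioms.
Memo `run/shared/lean/prim/prim-ineq-gen-6/FINDING-G30.md` §5.

At a first crossing `k` (one positive depth) the emission need factors as `v₁·B0_k` (improved blind bound), a double sum over
pairs (class `l′` of the C-channel copy, blind class `l` of the support copy).  The pairs with the C-defect BEYOND the blind class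
(`l′ > l`) are paid by the R-kill at depth `l` with at most two thirds of it (claim P1 of the memo); the two kernels below are its
algebraic core: `p0_lower_core` (the far factor `p₀` dominates `½·S_[2,l]·α_l·κ_l·p_l`, from the A-good and C-good root-cluster
masses and `u + v ≤ p`) and `pair_beyond_core` (the comparison itself, using `(1−s₁)W ≤ ¼`).
[cite: KozmaNitzan2024, Question 8 (§5.5 p. 36)]
-/

namespace Summit.CriticalPhenomena.PercolationContinuityZ3.Theorems

namespace PocketCert

/-- **Far-factor lower bound.**  With `p₀ ≥ E₁ ≥ S·α·(p − s·u)` (A-good root cluster through `[1,l]`), `p₀ ≥ Pi₁ ≥ S·κ·(p − s·v)`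
(C-good root cluster), `u + v ≤ p` (channels of `T_{l+1}`), `s ≤ 1`, `0 ≤ α, κ ≤ 1`, `S, p, u, v ≥ 0`:  `S·α·κ·p ≤ 2·p₀`.
[cite: KozmaNitzan2024, Question 8 (§5.5 p. 36)] -/
theorem p0_lower_core (p₀ E₁ Pi₁ S α κ p s u v : ℝ) (hE : E₁ ≤ p₀) (hPi : Pi₁ ≤ p₀)
    (hE1 : S * α * (p - s * u) ≤ E₁) (hPi1 : S * κ * (p - s * v) ≤ Pi₁) (huv : u + v ≤ p) (hs1 : s ≤ 1)
    (hα0 : 0 ≤ α) (hα1 : α ≤ 1) (hκ0 : 0 ≤ κ) (hκ1 : κ ≤ 1) (hS : 0 ≤ S) (hp : 0 ≤ p) (hu : 0 ≤ u) (hv : 0 ≤ v) :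
    S * α * κ * p ≤ 2 * p₀ := by
  have hSα : 0 ≤ S * α := mul_nonneg hS hα0
  have hSκ : 0 ≤ S * κ := mul_nonneg hS hκ0
  rcases le_or_gt u v with huv' | huv'
  · -- u ≤ p/2 :  E₁ ≥ Sα(p − su) ≥ Sα(p − u) ≥ Sα p/2 ≥ Sακ p/2
    have hu2 : 2 * u ≤ p := by linarith
    have h1 : S * α * (p - u) ≤ S * α * (p - s * u) := by
      apply mul_le_mul_of_nonneg_left _ hSα; nlinarith
    have h2 : S * α * κ * p ≤ 2 * (S * α * (p - u)) := by
      have : S * α * κ * p ≤ S * α * p := by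
        have := mul_le_mul_of_nonneg_left hκ1 (mul_nonneg hSα hp)
        nlinarith [this]
      nlinarith [mul_nonneg hSα (by linarith : (0:ℝ) ≤ p - 2 * u)]
    linarith
  · have hv2 : 2 * v ≤ p := by linarith
    have h1 : S * κ * (p - v) ≤ S * κ * (p - s * v) := by
      apply mul_le_mul_of_nonneg_left _ hSκ; nlinarith
    have h2 : S * α * κ * p ≤ 2 * (S * κ * (p - v)) := by
      have : S * α * κ * p ≤ S * κ * p := by
        have := mul_le_mul_of_nonneg_left hα1 (mul_nonneg hSκ hp)
        nlinarith [this]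
      nlinarith [mul_nonneg hSκ (by linarith : (0:ℝ) ≤ p - 2 * v)]
    linarith

/-- **P1, the 'beyond' pairs (core).**  For a blind class `l` (support `p_lκ_l(1−α_l)W_l`, weight `S_[2,l](1−s_{l+1})`) against the
C-bad mass beyond `l` (`S_[2,l+1]α_lκ_lv_{l+1}` inside `v₁`) and the R-kill `(1−s_{l+1})·¾κ_l(1−a₀α_l)v_{l+1}/(a₀α_lp_l)`, the cost is at
most two thirds of the kill.  Core inequality after cancelling the common positive factors
`(1−s_{l+1})κ_l²α_lv_{l+1}/(a₀p₀α_lp_l)`:  `(1−s₁)·W·S·S′·p²·κ·α²·(1−α) ≤ ½·p₀·(1−a₀α)`, given `0 ≤ W ≤ a₀λ ≤ s₁ ≤ 1`,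
`S′ ≤ 1` (`S′ = S_[2,l+1]`), `S·α·κ·p ≤ 2p₀` (`p0_lower_core`), `a₀ ≤ 1`, `0 ≤ α ≤ 1`, `κ, S, p ≥ 0`, `p ≤ 1`.
[cite: KozmaNitzan2024, Question 8 (§5.5 p. 36)] -/
theorem pair_beyond_core (s₁ W al S S' p κ α a₀ p₀ : ℝ) (hs1 : s₁ ≤ 1) (hW0 : 0 ≤ W) (hWal : W ≤ al)
    (hal : al ≤ s₁) (hS : 0 ≤ S) (hS' : 0 ≤ S') (hS'1 : S' ≤ 1) (hp : 0 ≤ p) (hp1 : p ≤ 1) (hκ : 0 ≤ κ) (hα0 : 0 ≤ α) (hα1 : α ≤ 1)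
    (ha1 : a₀ ≤ 1) (hp₀ : S * α * κ * p ≤ 2 * p₀) :
    (1 - s₁) * W * S * S' * p ^ 2 * κ * α ^ 2 * (1 - α) ≤ 1 / 2 * p₀ * (1 - a₀ * α) := by
  have h1 : (1 - s₁) * W ≤ 1 / 4 := by nlinarith [sq_nonneg (1 - 2 * s₁)]
  have h1' : 0 ≤ (1 - s₁) * W := mul_nonneg (by linarith) hW0
  have h2 : 1 - α ≤ 1 - a₀ * α := by nlinarith
  have h2' : 0 ≤ 1 - α := by linarith
  -- S S' p² κ α² ≤ (S α κ p)·(S' p α) ≤ 2 p₀ · 1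
  have h3 : S * S' * p ^ 2 * κ * α ^ 2 ≤ 2 * p₀ := by
    have e : S * S' * p ^ 2 * κ * α ^ 2 = (S * α * κ * p) * (S' * p * α) := by ring
    have hx : S' * p * α ≤ 1 := by
      calc S' * p * α ≤ 1 * 1 * 1 := by
            apply mul_le_mul (mul_le_mul hS'1 hp1 hp (by norm_num)) hα1 hα0 (by positivity)
        _ = 1 := by ring
    have hx0 : 0 ≤ S' * p * α := by positivity
    have h0 : 0 ≤ S * α * κ * p := by positivity
    rw [e]
    calc (S * α * κ * p) * (S' * p * α) ≤ (2 * p₀) * 1 := mul_le_mul hp₀ hx hx0 (by linarith)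
      _ = 2 * p₀ := by ring
  have hp₀0 : 0 ≤ p₀ := by
    have : 0 ≤ S * α * κ * p := by positivity
    linarith
  calc (1 - s₁) * W * S * S' * p ^ 2 * κ * α ^ 2 * (1 - α)
      = ((1 - s₁) * W) * (S * S' * p ^ 2 * κ * α ^ 2) * (1 - α) := by ring
    _ ≤ (1 / 4) * (2 * p₀) * (1 - a₀ * α) := by
        apply mul_le_mul (mul_le_mul h1 h3 (by positivity) (by norm_num)) h2 h2' (by positivity)
    _ = 1 / 2 * p₀ * (1 - a₀ * α) := by ring

end PocketCert

end Summit.CriticalPhenomena.PercolationContinuityZ3.Theorems
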